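import Summits.ValiantsHypothesis.ValiantsHypothesis.Theorems.GrenetZeonDualUnipotentThreeHalvesLongMassMixedWords

/-!
# `GrenetZeon.DualUnipotentThreeHalves` (stmt-ValiantsHypothesis-24318), line `slow_core`, stub (c) `SlowCore.LongMassSlowLawInv`:
# ALL MIXED WORDS OF LENGTH `≥ H` VANISH on a nil space of index `H` — and the TOP-WINDOW CRITERION (U2♭)

Companion to ✓ `…LongMassNilSpaceSandwich` (chain sandwich law), in the MIXED-WORD DICTIONARY of ✓ `…LongMassMixedWords`
(`window_iff_mixedWords`: a window pair `(W, k)` of `V` IS the vanishing of all `(A, w)`-word sums with more than `k` letters `w`).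

Let `V ≤ M_b(ℂ)` be a nilpotent space of uniform index `≤ H` (`X ^ H = 0` for all `X ∈ V`).  For `A, w ∈ V`:

* ★ `lineMat_pow_eq_zero` — the line matrix `(A + s·w)^p ∈ M_b(ℂ[s])` is ZERO for every `p ≥ H` (polynomial identity, ✓ `MvPolynomial.funext`);
* ★★ `mixedWords_eq_zero` — hence EVERY mixed word sum `Σ_{|ε| = q} word_ε(A, w)` of length `p ≥ H` vanishes, for every `q`
  (the complete list of identities of the pair `(A, w)`; `q = 1` is Gerstenhaber's first-order identity ✓ `NilSpaceSandwich.oneLetter_eq_zero`);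
* ★★ `window_of_pow_succ_eq_zero` — **TOP-WINDOW CRITERION (U2♭)**: if `H ≤ k + 2`, then `(W, k)` is a window pair of `V` (at ANY window `n`)
  as soon as `w ^ (k+1) = 0` for all `w ∈ W` — one step below the absorb ceiling U2 (`k = H − 1`, ✓ `Ceilings.relCert_absorb`) the deep
  mode is VACUOUS: the window property at order `H − 2` is EXACTLY the pure index condition `w^{H−1} = 0` on `W` (converse ✓
  `pow_eq_zero_of_window`);
* ★ `exists_window_top` — so `price_n(V) ≤ n·(H − 2) + t_{H−1}(V)`, `t_{H−1}(V)` = the least codimension of a sub-module of `V` inside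
  `{w : w^{H−1} = 0}` (crit-7's RelMMS quantity at `κ = H − 1`), in the submodule currency of ✓ `longMassSlowLawInv_iff_submodule`.

HONEST FRAMING.  Dictionary entries / a one-step ceiling (`--supports stmt-ValiantsHypothesis-24318`); NOT progress on (c) `SlowCore.LongMassSlowLawInv`
(RESEARCH — OPEN); closes no stub; S3, 24318, 8062 and `VP ≠ VNP` are NOT proved.  Def-free, no named facts, no sorry.
-/

set_option linter.dupNamespace false
set_option autoImplicit false

noncomputable section

namespace Summit.ValiantsHypothesis.ValiantsHypothesis.Theorems.GrenetZeon.NilSpaceWords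

open MvPolynomial Matrix
open scoped BigOperators
open Summit.ValiantsHypothesis.ValiantsHypothesis.Theorems.GrenetZeon.LongMassHomogenise (coeff_lineMat_pow_eq_sum_words)
open Summit.ValiantsHypothesis.ValiantsHypothesis.Theorems.GrenetZeon.InitialForm.SlowCurve (totalDegree_le_iff_coeff)

variable {b : ℕ}

/-! ## §1 Line powers of length `≥ H` vanish identically -/

/-- Evaluating the line matrix `A·C + s·(w·C)` at `s = y 0`. -/
theorem eval_mapMatrix_lineMat (A w : Matrix (Fin b) (Fin b) ℂ) (y : Fin 1 → ℂ) :
    (MvPolynomial.eval y).mapMatrix (A.map (C : ℂ → MvPolynomial (Fin 1) ℂ) + (X 0 : MvPolynomial (Fin 1) ℂ) • w.map C) =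
      A + (y 0) • w := by
  refine Matrix.ext fun i j => ?_
  simp [Matrix.map_apply]

/-- ★ In a nil space of uniform index `≤ H`, the line matrix `(A + s·w)^p` VANISHES for `p ≥ H` (`A, w ∈ V`). -/
theorem lineMat_pow_eq_zero (V : Submodule ℂ (Matrix (Fin b) (Fin b) ℂ)) {H : ℕ} (hV : ∀ X ∈ V, X ^ H = 0)
    {A w : Matrix (Fin b) (Fin b) ℂ} (hA : A ∈ V) (hw : w ∈ V) {p : ℕ} (hp : H ≤ p) :
    (A.map (C : ℂ → MvPolynomial (Fin 1) ℂ) + (X 0 : MvPolynomial (Fin 1) ℂ) • w.map C) ^ p = 0 := by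
  set P := A.map (C : ℂ → MvPolynomial (Fin 1) ℂ) + (X 0 : MvPolynomial (Fin 1) ℂ) • w.map C with hP
  refine Matrix.ext fun i j => ?_
  rw [Matrix.zero_apply]
  apply MvPolynomial.funext
  intro y
  have h1 : (MvPolynomial.eval y).mapMatrix (P ^ p) = 0 := by
    rw [map_pow, hP, eval_mapMatrix_lineMat]
    have hmem : A + y 0 • w ∈ V := V.add_mem hA (V.smul_mem _ hw)
    rw [← Nat.add_sub_cancel' hp, pow_add, hV _ hmem, Matrix.zero_mul]
  have h2 := congr_fun (congr_fun h1 i) j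
  simpa [Matrix.map_apply] using h2

/-! ## §2 All mixed word sums of length `≥ H` vanish -/

/-- ★★ **ALL MIXED WORDS VANISH FROM LENGTH `H` ON.**  In a nil space of uniform index `≤ H`, for `A, w ∈ V`, every `p ≥ H` and every `q`:
`Σ_{ε : Fin p → Bool, |ε| = q} Π_i (if ε i then w else A) = 0`. -/
theorem mixedWords_eq_zero (V : Submodule ℂ (Matrix (Fin b) (Fin b) ℂ)) {H : ℕ} (hV : ∀ X ∈ V, X ^ H = 0)
    {A w : Matrix (Fin b) (Fin b) ℂ} (hA : A ∈ V) (hw : w ∈ V) {p : ℕ} (hp : H ≤ p) (q : ℕ) :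
    (∑ ε ∈ (Finset.univ : Finset (Fin p → Bool)).filter (fun ε => (∑ i, if ε i then 1 else 0) = q),
        (List.ofFn fun i => if ε i then w else A).prod) = 0 := by
  refine Matrix.ext fun i j => ?_
  rw [← coeff_lineMat_pow_eq_sum_words, lineMat_pow_eq_zero V hV hA hw hp, Matrix.zero_apply, Matrix.zero_apply, coeff_zero]

/-! ## §3 The top-window criterion (U2♭) -/

/-- The number of letters `w` in a word of length `p` is at most `p`. -/
theorem count_true_le (p : ℕ) (ε : Fin p → Bool) : (∑ i, if ε i then 1 else 0) ≤ p := by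
  calc (∑ i, if ε i then 1 else 0) ≤ ∑ _i : Fin p, 1 := Finset.sum_le_sum fun i _ => by split_ifs <;> simp
    _ = p := by simp

/-- A word of length `p` with `p` letters `w` is the pure word. -/
theorem eq_true_of_count_eq (p : ℕ) (ε : Fin p → Bool) (h : (∑ i, if ε i then 1 else 0) = p) : ε = fun _ => true := by
  funext i
  by_contra hi
  have hi' : ε i = false := by simpa using hi
  have hlt : (∑ l, if ε l then 1 else 0) < ∑ _l : Fin p, 1 :=
    Finset.sum_lt_sum (fun l _ => by split_ifs <;> simp) ⟨i, Finset.mem_univ _, by simp [hi']⟩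
  rw [Finset.sum_const, Finset.card_univ, Fintype.card_fin, smul_eq_mul, mul_one] at hlt
  omega

/-- ★★ **TOP-WINDOW CRITERION (U2♭).**  In a nil space `V` of uniform index `≤ H`, a sub-module `W ≤ V` with `w ^ (k+1) = 0` for all `w ∈ W`
is a window pair `(W, k)` at every window `n`, PROVIDED `H ≤ k + 2`: words of length `≥ H` vanish (`mixedWords_eq_zero`), and a word of
length `p ≤ H − 1 ≤ k + 1` with more than `k` letters `w` is the pure word `w^{k+1} = 0`. -/
theorem window_of_pow_succ_eq_zero (V W : Submodule ℂ (Matrix (Fin b) (Fin b) ℂ)) {H k : ℕ} (n : ℕ)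
    (hV : ∀ X ∈ V, X ^ H = 0) (hWV : W ≤ V) (hk : H ≤ k + 2) (hW : ∀ w ∈ W, w ^ (k + 1) = 0) :
    ∀ A ∈ V, ∀ w ∈ W, ∀ p : ℕ, p ≤ n - 1 → ∀ i j : Fin b,
      ((((A.map (C : ℂ → MvPolynomial (Fin 1) ℂ) + (X 0 : MvPolynomial (Fin 1) ℂ) • w.map C) ^ p :
        Matrix (Fin b) (Fin b) (MvPolynomial (Fin 1) ℂ)) i j).totalDegree ≤ k) := by
  classical
  intro A hA w hw p _ i j
  rw [totalDegree_le_iff_coeff]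
  intro e he
  rw [coeff_lineMat_pow_eq_sum_words]
  by_cases hp : H ≤ p
  · rw [mixedWords_eq_zero V hV hA (hWV hw) hp e, Matrix.zero_apply]
  · by_cases hep : p < e
    · rw [Finset.filter_false_of_mem, Finset.sum_empty, Matrix.zero_apply]
      intro ε _ hε
      have := count_true_le p ε
      omega
    · have hpe : p = e := by omega
      have hpk : p = k + 1 := by omega
      subst hpe
      have hfilter : ((Finset.univ : Finset (Fin p → Bool)).filter fun ε => (∑ i, if ε i then 1 else 0) = p) =
          {fun _ => true} := by
        ext ε
        simp only [Finset.mem_filter, Finset.mem_univ, true_and, Finset.mem_singleton]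
        constructor
        · exact eq_true_of_count_eq p ε
        · rintro rfl; simp
      rw [hfilter, Finset.sum_singleton]
      have hprod : (List.ofFn fun i : Fin p => if (fun _ : Fin p => true) i then w else A).prod = w ^ p := by
        simp [List.ofFn_const, List.prod_replicate]
      rw [hprod, hpk, hW w hw, Matrix.zero_apply]

/-- ★ **U2♭ AS A PRICE.**  In a nil space `V` of uniform index `≤ H` (`2 ≤ H`), every sub-module `W ≤ V` on which `w ^ (H−1) = 0` is a window pair
of order `H − 2`, of cost `n·(H−2) + (dim V − dim W)` — i.e. `price_n(V) ≤ n·(H−2) + t_{H−1}(V)` in the currency of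
✓ `longMassSlowLawInv_iff_submodule`. -/
theorem exists_window_top (V W : Submodule ℂ (Matrix (Fin b) (Fin b) ℂ)) {H : ℕ} (n : ℕ)
    (hV : ∀ X ∈ V, X ^ H = 0) (hWV : W ≤ V) (hH : 2 ≤ H) (hW : ∀ w ∈ W, w ^ (H - 1) = 0) :
    ∃ (W' : Submodule ℂ (Matrix (Fin b) (Fin b) ℂ)) (k : ℕ), W' ≤ V ∧
      (∀ A ∈ V, ∀ w ∈ W', ∀ p : ℕ, p ≤ n - 1 → ∀ i j : Fin b,
        ((((A.map (C : ℂ → MvPolynomial (Fin 1) ℂ) + (X 0 : MvPolynomial (Fin 1) ℂ) • w.map C) ^ p :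
          Matrix (Fin b) (Fin b) (MvPolynomial (Fin 1) ℂ)) i j).totalDegree ≤ k)) ∧
      n * k + (Module.finrank ℂ V - Module.finrank ℂ W') = n * (H - 2) + (Module.finrank ℂ V - Module.finrank ℂ W) := by
  refine ⟨W, H - 2, hWV, window_of_pow_succ_eq_zero V W n hV hWV (by omega) (fun w hw => ?_), rfl⟩
  rw [show H - 2 + 1 = H - 1 by omega]
  exact hW w hw

/-- The absorb ceiling U2 recovered in this currency (`W = V`, `k = H − 1`; `1 ≤ H`). -/
theorem window_self_absorb (V : Submodule ℂ (Matrix (Fin b) (Fin b) ℂ)) {H : ℕ} (n : ℕ)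
    (hV : ∀ X ∈ V, X ^ H = 0) (hH : 1 ≤ H) :
    ∀ A ∈ V, ∀ w ∈ V, ∀ p : ℕ, p ≤ n - 1 → ∀ i j : Fin b,
      ((((A.map (C : ℂ → MvPolynomial (Fin 1) ℂ) + (X 0 : MvPolynomial (Fin 1) ℂ) • w.map C) ^ p :
        Matrix (Fin b) (Fin b) (MvPolynomial (Fin 1) ℂ)) i j).totalDegree ≤ H - 1) :=
  window_of_pow_succ_eq_zero V V n hV le_rfl (by omega) (fun w hw => by rw [Nat.sub_add_cancel hH]; exact hV w hw)

/-! ## §4 The deep mode lives strictly below length `H` -/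

open Summit.ValiantsHypothesis.ValiantsHypothesis.Theorems.GrenetZeon.LongMassHomogenise (window_iff_mixedWords)

/-- ★★ **SHORT-WORD DICTIONARY.**  For a nil space `V` of uniform index `≤ H` and `W ≤ V`, `(W, k)` is a window pair of `V` at window `n`
IFF every mixed word sum of length `p < H` (and `p ≤ n − 1`) with more than `k` letters `w` vanishes — the words of length `≥ H` are free
(`mixedWords_eq_zero`).  Sharpens ✓ `window_iff_mixedWords`. -/
theorem window_iff_shortWords (V W : Submodule ℂ (Matrix (Fin b) (Fin b) ℂ)) {H : ℕ} (n k : ℕ)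
    (hV : ∀ X ∈ V, X ^ H = 0) (hWV : W ≤ V) :
    (∀ A ∈ V, ∀ w ∈ W, ∀ p : ℕ, p ≤ n - 1 → ∀ i j : Fin b,
      ((((A.map (C : ℂ → MvPolynomial (Fin 1) ℂ) + (X 0 : MvPolynomial (Fin 1) ℂ) • w.map C) ^ p :
        Matrix (Fin b) (Fin b) (MvPolynomial (Fin 1) ℂ)) i j).totalDegree ≤ k)) ↔
    (∀ A ∈ V, ∀ w ∈ W, ∀ p : ℕ, p ≤ n - 1 → p < H → ∀ q : ℕ, k < q →
      (∑ ε ∈ (Finset.univ : Finset (Fin p → Bool)).filter (fun ε => (∑ i, if ε i then 1 else 0) = q),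
        (List.ofFn fun i => if ε i then w else A).prod) = 0) := by
  rw [window_iff_mixedWords]
  constructor
  · intro h A hA w hw p hp _ q hq
    exact h A hA w hw p hp q hq
  · intro h A hA w hw p hp q hq
    by_cases hpH : p < H
    · exact h A hA w hw p hp hpH q hq
    · exact mixedWords_eq_zero V hV hA (hWV hw) (not_lt.mp hpH) q

/-- ★ **ORDER `H − 3` (the first order where the deep mode bites), word form.**  For a nil space `V` of uniform index `≤ H` with `3 ≤ H ≤ n`
and `W ≤ V`: `(W, H − 3)` is a window pair at window `n` iff for all `A ∈ V`, `w ∈ W` the three word sums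
`w^{H−2}` (length `H−2`, no `A`), `w^{H−1}` (length `H−1`, no `A`) and the ONE-`A` sum of length `H − 1`,
`Σ_{i+j=H−2} w^i · A · w^j`, vanish — here all three written as word sums (`q = p` resp. `q = p − 1`). -/
theorem window_order_sub_three_iff (V W : Submodule ℂ (Matrix (Fin b) (Fin b) ℂ)) {H : ℕ} (n : ℕ)
    (hV : ∀ X ∈ V, X ^ H = 0) (hWV : W ≤ V) (hH : 3 ≤ H) (hn : H ≤ n) :
    (∀ A ∈ V, ∀ w ∈ W, ∀ p : ℕ, p ≤ n - 1 → ∀ i j : Fin b,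
      ((((A.map (C : ℂ → MvPolynomial (Fin 1) ℂ) + (X 0 : MvPolynomial (Fin 1) ℂ) • w.map C) ^ p :
        Matrix (Fin b) (Fin b) (MvPolynomial (Fin 1) ℂ)) i j).totalDegree ≤ H - 3)) ↔
    (∀ A ∈ V, ∀ w ∈ W, ∀ p : ℕ, H - 2 ≤ p → p < H → ∀ q : ℕ, H - 3 < q →
      (∑ ε ∈ (Finset.univ : Finset (Fin p → Bool)).filter (fun ε => (∑ i, if ε i then 1 else 0) = q),
        (List.ofFn fun i => if ε i then w else A).prod) = 0) := by
  rw [window_iff_shortWords V W n (H - 3) hV hWV]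
  constructor
  · intro h A hA w hw p _ hpH q hq
    exact h A hA w hw p (by omega) hpH q hq
  · intro h A hA w hw p _ hpH q hq
    by_cases hp : H - 2 ≤ p
    · exact h A hA w hw p hp hpH q hq
    · -- `p ≤ H - 3 < q`: no word of length `p` has `q` letters `w`
      rw [Finset.filter_false_of_mem, Finset.sum_empty]
      intro ε _ hε
      have := count_true_le p ε
      omega

end Summit.ValiantsHypothesis.ValiantsHypothesis.Theorems.GrenetZeon.NilSpaceWords

end
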